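import Summits.CriticalPhenomena.CardyFormulaZ2.Theorems.CardyBoundaryCoulombGasBoundaryDefectGaussianRStubRealisabilityPart48
import Summits.CriticalPhenomena.CardyFormulaZ2.Theorems.CardyBoundaryCoulombGasBoundaryDefectGaussianRStubHoleFree

/-!
# Stubs `stub_dictionaryPositivity` / `stub_rainbowNonempty` of line
# `rainbow-monomials-in-excursion-kernels` — D2 completion, sub-goal `s17_eventually_regular`:
# the eventual regularity package of the lattice approximations
# (crux `BoundaryDefectGaussianR`, stmt-CriticalPhenomena-14132; insertion dictionary D2, glue)

Assembly of the five eventual regularity statements of the lattice approximations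
`V_n = {v ∈ ℤ² : δ_n v ∈ closure D}` of a rectilinear Jordan domain `D` along a mesh sequence
`δ_n → 0⁺` into the one registered conjunction used by the D2 completion skeleton:

* FLAT at radius `sinkLegs + 4` for the stubs' leg-insertion datum, uniformly in the configuration
  `p` (`s16_eventually_flat4`, …StubRealisabilityPart48);
* CHART at range `3` (`s16_eventually_chart`, …StubRealisabilityPart47);
* `V_n` lattice-connected with king-connected complement (`stub_holeFree`, …StubHoleFree);
* the king charts at range `6` of `s15_cellRegion_rim` (`s16_eventually_kingChart`,
  …StubRealisabilityPart48).

The five filters are intersected (`Filter.Eventually`, `filter_upwards`); nothing is re-proved.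
All [folklore].
-/

noncomputable section

open Filter Topology

namespace Summit.CriticalPhenomena.CardyFormulaZ2.Cruxes.BoundaryDefectGaussianR.RainbowMonomialsInExcursionKernels

open Literature.Probability.LatticeModels Literature.Probability.LatticeModels.CollarLegModel

/-- **Registered sub-goal `s17_eventually_regular`** of `stub_dictionaryPositivity` /
`stub_rainbowNonempty` (stmt-CriticalPhenomena-14132): along a mesh sequence `δ_n → 0⁺`, the
lattice approximations `V_n` of a rectilinear Jordan domain eventually satisfy, for every
injective admissible flat separated configuration `p` of insertion points, the regularity package
FLAT(`sinkLegs + 4`) ∧ CHART(3) ∧ lattice-connected ∧ king-connected complement ∧ KINGCHART(6).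
Pure assembly of `s16_eventually_flat4`, `s16_eventually_chart`, `stub_holeFree` and
`s16_eventually_kingChart`. [folklore] -/
theorem s17_eventually_regular : ∀ (k : ℕ) (L : Fin k → ℕ) (j : Fin k), L j = ∑ i ∈ Finset.univ.erase j, L i → ∀ (D : Literature.Probability.RandomPlanarGeometry.JordanDomain), (∃ S : Finset (ℂ × ℂ), (∀ q ∈ S, q.1.re = q.2.re ∨ q.1.im = q.2.im) ∧ frontier D.carrier ⊆ ⋃ q ∈ S, segment ℝ q.1 q.2) → ∀ (r : ℝ), 0 < r → ∀ (δ : ℕ → ℝ), (∀ n, 0 < δ n) → Filter.Tendsto δ Filter.atTop (nhds 0) → ∀ (V : ℕ → Finset (ℤ × ℤ)), (∀ n, ∀ v : ℤ × ℤ, v ∈ V n ↔ (((v).1 : ℂ) * ((δ n : ℝ) : ℂ) + ((v).2 : ℂ) * ((δ n : ℝ) : ℂ) * Complex.I) ∈ closure D.carrier) → ∀ᶠ n in Filter.atTop, ∀ (p : Fin k → ℤ × ℤ), Function.Injective p → Literature.Probability.LatticeModels.CollarLegModel.LegInsertionData.IsAdmissible (⟨(Finset.univ.erase j).image (p), fun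 v ↦ ∑ b ∈ (Finset.univ.erase j).filter (fun b ↦ (p) b = v), L b, (p) j⟩ : Literature.Probability.LatticeModels.CollarLegModel.LegInsertionData) (V n) → (∀ i', (∃ d : ℤ × ℤ, (d = (1, 0) ∨ d = (-1, 0) ∨ d = (0, 1) ∨ d = (0, -1)) ∧ ∀ v : ℤ × ℤ, (((((v).1 - (p i').1) ^ 2 + ((v).2 - (p i').2) ^ 2 : ℤ) : ℝ)) ≤ (r / δ n) ^ 2 → (v ∈ V n ↔ 0 ≤ (v.1 - (p i').1) * d.1 + (v.2 - (p i').2) * d.2))) → (∀ i₁ i₂ : Fin k, i₁ ≠ i₂ → (r / δ n) ^ 2 ≤ ((((((p) i₁).1 - ((p) i₂).1) ^ 2 + (((p) i₁).2 - ((p) i₂).2) ^ 2 : ℤ) : ℝ))) → (∀ x ∈ insert (⟨(Finset.univ.erase j).image (p), fun v ↦ ∑ b ∈ (Finset.univ.erase j).filter (fun b ↦ (p) b = v), L b, (p) j⟩ : Literature.Probability.LatticeModels.CollarLegModel.LegInsertionData).sink (⟨(Finset.univ.erase j).image (p), fun v ↦ ∑ b ∈ (Finset.univ.erase j).filter (fun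 b ↦ (p) b = v), L b, (p) j⟩ : Literature.Probability.LatticeModels.CollarLegModel.LegInsertionData).source, ∃ dvec : ℤ × ℤ, (dvec = (1, 0) ∨ dvec = (-1, 0) ∨ dvec = (0, 1) ∨ dvec = (0, -1)) ∧ ∀ v : ℤ × ℤ, (v.1 - x.1) ^ 2 + (v.2 - x.2) ^ 2 ≤ (((⟨(Finset.univ.erase j).image (p), fun v ↦ ∑ b ∈ (Finset.univ.erase j).filter (fun b ↦ (p) b = v), L b, (p) j⟩ : Literature.Probability.LatticeModels.CollarLegModel.LegInsertionData).sinkLegs : ℤ) + 4) ^ 2 → (v ∈ V n ↔ 0 ≤ (v.1 - x.1) * dvec.1 + (v.2 - x.2) * dvec.2)) ∧ (∀ u ∈ V n, ∀ k : Fin 4, u + Literature.Probability.LatticeModels.CollarLegModel.dir k ∉ V n → ∃ (K : Fin 4) (c₁ c₂ : ℤ), (∀ v : ℤ × ℤ, |v.1 - u.1| ≤ 3 → |v.2 - u.2| ≤ 3 → (v ∈ V n ↔ c₂ ≤ v.1 * (Literature.Probability.LatticeModels.CollarLegModel.dir (K + 1)).1 + v.2 * (Literature.Probability.LatticeModels.CollarLegModel.dir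 (K + 1)).2)) ∨ (∀ v : ℤ × ℤ, |v.1 - u.1| ≤ 3 → |v.2 - u.2| ≤ 3 → (v ∈ V n ↔ c₁ ≤ v.1 * (Literature.Probability.LatticeModels.CollarLegModel.dir K).1 + v.2 * (Literature.Probability.LatticeModels.CollarLegModel.dir K).2 ∧ c₂ ≤ v.1 * (Literature.Probability.LatticeModels.CollarLegModel.dir (K + 1)).1 + v.2 * (Literature.Probability.LatticeModels.CollarLegModel.dir (K + 1)).2)) ∨ (∀ v : ℤ × ℤ, |v.1 - u.1| ≤ 3 → |v.2 - u.2| ≤ 3 → (v ∈ V n ↔ c₂ ≤ v.1 * (Literature.Probability.LatticeModels.CollarLegModel.dir (K + 1)).1 + v.2 * (Literature.Probability.LatticeModels.CollarLegModel.dir (K + 1)).2 ∨ v.1 * (Literature.Probability.LatticeModels.CollarLegModel.dir K).1 + v.2 * (Literature.Probability.LatticeModels.CollarLegModel.dir K).2 ≤ c₁))) ∧ (∀ u ∈ V n, ∀ w ∈ V n, Relation.ReflTransGen (fun b c : ℤ × ℤ ↦ b ∈ V n ∧ c ∈ V n ∧ (b.1 - c.1) ^ 2 + (b.2 - c.2)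 ^ 2 = 1) u w) ∧ (∀ u ∉ V n, ∀ w ∉ V n, Relation.ReflTransGen (fun b c : ℤ × ℤ ↦ b ∉ V n ∧ c ∉ V n ∧ max |b.1 - c.1| |b.2 - c.2| ≤ 1) u w) ∧ (∀ z : ℤ × ℤ, z ∉ V n → (∃ v ∈ V n, max |v.1 - z.1| |v.2 - z.2| ≤ 1) → ∃ σ τ a c : ℤ, |σ| ≤ 1 ∧ |τ| ≤ 1 ∧ ((∀ v : ℤ × ℤ, max |v.1 - z.1| |v.2 - z.2| ≤ 6 → (v ∈ V n ↔ 0 ≤ σ * (v.1 - a) ∧ 0 ≤ τ * (v.2 - c))) ∨ (∀ v : ℤ × ℤ, max |v.1 - z.1| |v.2 - z.2| ≤ 6 → (v ∈ V n ↔ 0 < σ * (v.1 - a) ∨ 0 < τ * (v.2 - c))))) := by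
  intro k L j hL D hD r hr δ hδ hδ0 V hV
  have h1 := s16_eventually_flat4 k L j hL r hr δ hδ hδ0 V
  have h2 := s16_eventually_chart D hD δ hδ hδ0 V hV
  have h3 := stub_holeFree D hD δ hδ hδ0 V hV
  have h5 := s16_eventually_kingChart D hD δ hδ hδ0 V hV
  filter_upwards [h1, h2, h3, h5] with n h1 h2 h3 h5
  intro p _ _ hflat _
  exact ⟨h1 p hflat, h2, h3.1, h3.2, h5⟩

end Summit.CriticalPhenomena.CardyFormulaZ2.Cruxes.BoundaryDefectGaussianR.RainbowMonomialsInExcursionKernels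

end
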